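import Literature.NumberTheory.GelbartRogawski1991.DoubledWeilRepresentationIsometryTransport
import Literature.NumberTheory.GelbartRogawski1991.DoubledKroneckerConjugationFrame
import Literature.NumberTheory.GelbartRogawski1991.DoubledKroneckerConjugationSeesawRational
import HarnessLib

/-!
# χ-rigidity of the doubled Weil splitting under the doubled Kronecker conjugation of a rational isometry — THE MODEL
# ([GelbartRogawski1991] §3.1 Prop. 3.1.1; [Liu2021] Thm. 4.15 proof l. 2199–2210, the see-saw frame change)

Topic `NumberTheory/GelbartRogawski1991`; namespace `Literature.NumberTheory.GelbartRogawski1991.GRConstruction`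
(sequel of `DoubledWeilRepresentationIsometryTransport.lean` (generic `r C θ`), `DoubledKroneckerConjugationFrame.lean`
(`thetaD`, `aOfB`, `thetaF`, the Siegel clauses `thetaD_square` / `isSiegelDelta_thetaD` / `detDelta_thetaD_of_isSiegelDelta`)
and `DoubledKroneckerConjugationSeesawRational.lean` (`rD = r_F^𝔻(seesawDRat)`, `hpar_rD`)).  THEOREMS ONLY (2); no definition,
no named fact, no instance, no `sorry`.

For two V-frames `dV`, `dV′` related by a RATIONAL isometry `a = a₀ ⊗ 1` (`ha`), a rational relabelling `C = C₀ ⊗ 1` with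
`hC : T^𝔻[dV]·C = T^𝔻[dV′]`, and a unitary splitting character `χ`:
* **`conjSplitting_doubledWeilRep_comp_thetaD_of_finPart`** — for Weil's lift `rD` of the doubled see-saw element and the
  doubled conjugation `θ^𝔻 = Ad(kronAD e a)`: `conjSplitting rD (relabCD e C) _ (doubledWeilRep[dV] χ ∘ θ^𝔻) = doubledWeilRep[dV′] χ`,
  the finite part `θf` of `θ^𝔻` a binder (= the generic head `conjSplitting_doubledWeilRep_comp_eq_of_finPart` fed with
  `thetaD_square`, `isSiegelDelta_thetaD`, `detDelta_thetaD_of_isSiegelDelta`, `hpar_rD`);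
* **`conjSplitting_doubledWeilRep_comp_thetaD`** — ZERO external hypotheses at the frame datum `(B : GL (Fin N) L)`,
  `hB : formCongr c̄ B ((1:L) • diagonal dV′) = diagonal dV`: `a := aOfB B`, `θf := thetaF … B hB` (`continuous_thetaF`,
  `thetaD_finAdelicToAdelic`).
Consumers: the frame independence of `ω(μ,ε,χ)` ([Liu2021] Def. 4.11) — `Liu2021/Def411WeilCarriersFrameTransportHolds.lean`.
HC_CM is proved only modulo the 7 printed citations until rung 0 closes; nothing of [Liu2021] App. D is asserted here.

References: [GelbartRogawski1991] S. Gelbart, J. Rogawski, Invent. Math. 105 (1991), §3.1 Prop. 3.1.1 p. 455 L1–2.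
[Kudla1994] S. Kudla, Israel J. Math. 87 (1994), §2, §3 Thm. 3.1.  [HarrisKudlaSweet1996] J. Amer. Math. Soc. 9 (1996), §1
(1.14)–(1.15), Cor. A.3 p. 998.  [Liu2021] Y. Liu, Thm. 4.15 proof l. 2199–2210.
-/

set_option autoImplicit false

noncomputable section

namespace Literature.NumberTheory.GelbartRogawski1991.GRConstruction

open Matrix NumberField IsDedekindDomain
open scoped Kronecker
open Literature.NumberTheory.GaloisRepresentations
open Literature.RepresentationTheory.HarrisKudlaSweet1996
open Literature.RepresentationTheory.HeisenbergGroup Literature.RepresentationTheory.HeisenbergGroup.SymplecticMatrix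
  Literature.NumberTheory.Weil1964
open Literature.NumberTheory.Automorphic hiding reindexGL coe_reindexGL
open UnitaryDualPair Literature.NumberTheory.Automorphic.UnitaryGroup
open Literature.NumberTheory.Automorphic.Liu2021.Def411WeilCarriersDoubling

section Join

variable (L : Type) [Field L] [NumberField L] [IsCMField L]
  {N M n : ℕ} (e : Fin N × Fin M ≃ Fin n)
  (dV : Fin N → L) (hdV : ∀ i, IsCMField.complexConj L (dV i) = dV i) (hdV0 : ∀ i, dV i ≠ 0)
  (dV' : Fin N → L) (hdV' : ∀ i, IsCMField.complexConj L (dV' i) = dV' i) (hdV'0 : ∀ i, dV' i ≠ 0)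
  (dW : Fin M → L) (hdW : ∀ i, IsCMField.complexConj L (dW i) = dW i) (hdW0 : ∀ i, dW i ≠ 0)

-- (no local notation inside `variable` binders: a notation capturing the section variable `L` elaborates to `sorry` there)
variable {a : GL (Fin N) (AdeleRing (𝓞 L) L)} {a₀ : GL (Fin N) L}
  (haa₀ : (a : Matrix (Fin N) (Fin N) (AdeleRing (𝓞 L) L)) =
    ((a₀ : GL (Fin N) L) : Matrix (Fin N) (Fin N) L).map (algebraMap L (AdeleRing (𝓞 L) L)))
  (ha : ((a : Matrix (Fin N) (Fin N) (AdeleRing (𝓞 L) L)).map (conjAdele (Fp L) L (IsCMField.complexConj L)))ᵀ *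
      adelicForm L N (Matrix.diagonal dV) * a = adelicForm L N (Matrix.diagonal dV'))
  {C : GL (Fin N × Fin M) (AdeleRing (𝓞 (Fp L)) (Fp L))} {C₀ : GL (Fin N × Fin M) (Fp L)}
  (hCC₀ : (C : Matrix (Fin N × Fin M) (Fin N × Fin M) (AdeleRing (𝓞 (Fp L)) (Fp L))) =
    ((C₀ : GL (Fin N × Fin M) (Fp L)) : Matrix (Fin N × Fin M) (Fin N × Fin M) (Fp L)).map
      (algebraMap (Fp L) (AdeleRing (𝓞 (Fp L)) (Fp L))))
  (hC : (realDiagonal L dV hdV).map (algebraMap (Fp L) (AdeleRing (𝓞 (Fp L)) (Fp L))) ⊗ₖ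
        (realDiagonal L dW hdW).map (algebraMap (Fp L) (AdeleRing (𝓞 (Fp L)) (Fp L))) *
      (C : Matrix (Fin N × Fin M) (Fin N × Fin M) (AdeleRing (𝓞 (Fp L)) (Fp L))) =
    (realDiagonal L dV' hdV').map (algebraMap (Fp L) (AdeleRing (𝓞 (Fp L)) (Fp L))) ⊗ₖ
      (realDiagonal L dW hdW).map (algebraMap (Fp L) (AdeleRing (𝓞 (Fp L)) (Fp L))))

include haa₀ hCC₀ in
/-- **(T4) AT THE MODEL, generic rational isometry `a = a₀ ⊗ 1`**: for Weil's lift `rD` of the doubled see-saw element, the doubled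
relabelling `relabCD e C` and `θ^𝔻 = Ad(kronAD e a)`,
`conjSplitting rD (relabCD e C) _ (doubledWeilRep[dV] χ ∘ θ^𝔻) = doubledWeilRep[dV′] χ` — the head (§E :464) fed with `thetaD_square` (`hθsq`),
`isSiegelDelta_thetaD` (`hθΔ`), `detDelta_thetaD_of_isSiegelDelta` (`hθdet`), `hpar_rD` (`hpar`); the finite part `θf` of `θ^𝔻` stays a binder here.
[cite: Liu2021, Thm. 4.15 proof l. 2199–2210] [cite: HarrisKudlaSweet1996, §1 (1.14)–(1.15), Cor. A.3 p. 998] [cite: Kudla1994, §2 (doubled space, Siegel parabolic), Thm. 3.1] -/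
theorem conjSplitting_doubledWeilRep_comp_thetaD_of_finPart
    (θf : UnitaryGroup.finAdelic (Fp L) L (IsCMField.complexConj L) (n + n) (hermD L e dV' hdV' dW hdW) →*
      UnitaryGroup.finAdelic (Fp L) L (IsCMField.complexConj L) (n + n) (hermD L e dV hdV dW hdW))
    (hθfc : Continuous θf)
    (hθf : ∀ k, thetaD L e dV hdV dV' hdV' dW hdW a ha
        (UnitaryGroup.finAdelicToAdelic (Fp L) L (IsCMField.complexConj L) (n + n) (hermD L e dV' hdV' dW hdW) k) =
      UnitaryGroup.finAdelicToAdelic (Fp L) L (IsCMField.complexConj L) (n + n) (hermD L e dV hdV dW hdW) (θf k))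
    (χ : HeckeCharacter L) (hχu : χ.IsUnitary) (hχs : IsSplittingChar L 1 χ) :
    conjSplitting (Fp L) (Fin (n + n)) (rD L e dV hdV hdV0 dV' hdV' dW hdW hdW0 haa₀ ha hCC₀ hC) (relabCD e C)
        (gramDA_mul_relabCD L e dV hdV dV' hdV' dW hdW C hC)
        ((doubledWeilRep L e dV hdV hdV0 dW hdW hdW0 χ hχu hχs).comp (thetaD L e dV hdV dV' hdV' dW hdW a ha)) =
      doubledWeilRep L e dV' hdV' hdV'0 dW hdW hdW0 χ hχu hχs :=
  conjSplitting_doubledWeilRep_comp_eq_of_finPart (hdV0 := hdV0) (hdV'0 := hdV'0) (hdW0 := hdW0)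
    (rD L e dV hdV hdV0 dV' hdV' dW hdW hdW0 haa₀ ha hCC₀ hC) (relabCD e C) (gramDA_mul_relabCD L e dV hdV dV' hdV' dW hdW C hC)
    (thetaD L e dV hdV dV' hdV' dW hdW a ha) (thetaD_square L e dV hdV hdV0 dV' hdV' dW hdW hdW0 haa₀ ha hCC₀ hC)
    (isSiegelDelta_thetaD a ha) (detDelta_thetaD_of_isSiegelDelta a ha)
    (hpar_rD L e dV hdV hdV0 dV' hdV' hdV'0 dW hdW hdW0 haa₀ ha hCC₀ hC) θf hθfc hθf χ hχu hχs

include hCC₀ in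
/-- **(T4) ZERO-HYPOTHESIS SLOT TEST at the (T) socket datum `(B, hB)`**: with `a := aOfB L B = B⁻¹ ⊗ 1` (`coe_aOfB`, `aOfB_isometry`) and the
finite part `θf := thetaF … B hB` (`continuous_thetaF`, `thetaD_finAdelicToAdelic`), the doubled-isometry transport identity
`conjSplitting rD (relabCD e C) _ (doubledWeilRep[dV] χ ∘ θ^𝔻) = doubledWeilRep[dV′] χ` holds with NO hypothesis beyond the data
(`B`, `hB`, the rational relabelling `C = C₀ ⊗ 1` with `(T_V ⊗ T_W)·C = T_V′ ⊗ T_W`, `χ` unitary splitting).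
[cite: Liu2021, Thm. 4.15 proof l. 2199–2210] [cite: HarrisKudlaSweet1996, §1 (1.14)–(1.15), Cor. A.3 p. 998] [cite: Kudla1994, §2 (doubled space, Siegel parabolic), Thm. 3.1]
[cite: PlatonovRapinchuk1994, §5.1] -/
theorem conjSplitting_doubledWeilRep_comp_thetaD (B : GL (Fin N) L)
    (hB : formCongr ((IsCMField.complexConj L : L ≃ₐ[Fp L] L) : L →+* L) B ((1 : L) • Matrix.diagonal dV') = Matrix.diagonal dV)
    (χ : HeckeCharacter L) (hχu : χ.IsUnitary) (hχs : IsSplittingChar L 1 χ) :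
    conjSplitting (Fp L) (Fin (n + n))
        (rD L e dV hdV hdV0 dV' hdV' dW hdW hdW0 (coe_aOfB L B) (aOfB_isometry L dV dV' B hB) hCC₀ hC) (relabCD e C)
        (gramDA_mul_relabCD L e dV hdV dV' hdV' dW hdW C hC)
        ((doubledWeilRep L e dV hdV hdV0 dW hdW hdW0 χ hχu hχs).comp
          (thetaD L e dV hdV dV' hdV' dW hdW (aOfB L B) (aOfB_isometry L dV dV' B hB))) =
      doubledWeilRep L e dV' hdV' hdV'0 dW hdW hdW0 χ hχu hχs :=
  conjSplitting_doubledWeilRep_comp_thetaD_of_finPart L e dV hdV hdV0 dV' hdV' hdV'0 dW hdW hdW0 (coe_aOfB L B)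
    (aOfB_isometry L dV dV' B hB) hCC₀ hC (thetaF L e dV hdV dV' hdV' dW hdW B hB) (continuous_thetaF L e dV hdV dV' hdV' dW hdW B hB)
    (thetaD_finAdelicToAdelic L e dV hdV dV' hdV' dW hdW B hB) χ hχu hχs

end Join

end Literature.NumberTheory.GelbartRogawski1991.GRConstruction

end
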